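import Literature.Analysis.FluidPDE.StatisticalSolutionEnergyEq
import Literature.Analysis.FluidPDE.CylindricalGenerator
import Summits.AnomalousDissipation.AnomalousDissipation.Theorems.StirringSphereEnsembleRealizationStubAugCurrentField
import Summits.AnomalousDissipation.AnomalousDissipation.Theorems.StirringSphereEnsembleRealizationStubAugCurrentLevelTransport

/-!
# Crux `EnsembleRealization` (stmt-AnomalousDissipation-0215) — line `augmented-lift`,
# sub-stub (M1a) `stub_augCurrentLevelPairs`, piece (L5)/Marg: the marginal link

Supports stmt-AnomalousDissipation-0215 (stub `stub_augCurrentLevelPairs` of line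
`augmented-lift`, piece L5 `stub_augCurrentLevelLinkTools`, MARG part of step (A6) of
`augCurrent-notes.md` §3). Nothing here closes an item. Theorems only.

MARG LINK. Along a sequence of levels (bases `g n` complete for `P_{N n}` with `N n → ∞`,
one-sided product mollifiers `ρ₁ n ⊗ ρ₂ n` of width `δ n → 0`, mollified coordinate laws
`p₁ n(z) = ∫ ρ(z − Z u) dμ`, mixing weights `ε n → 0`, `θ n = R/(R + δ n)`, level laws `m n` given by
the transport formula `∫ G d(m n) = (1 − ε) ∫ G p₁ + ε c ∫_{Bx} G`), the law of
`(𝓕(θ Σ zⱼ gⱼ), z.2)` under `m n` tends to the law of `(û, ‖u‖²)` under `μ` against bounded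
continuous tests: transport (`stub_augCurrentLevelTransportTools`) reduces to
`∫ (∫ φ(Ψ_n(Z u + y)) ρ_n(y) dy) dμ`, dominated convergence in `u`, and pointwise convergence from
`Ψ_n(Z u + y).1 k = θ_n (𝓕(P_{N n} u)(k) + Ŷ(k))`, `‖Ŷ(k)‖ ≤ ‖y‖ ≤ δ_n`, `(1 − θ_n)‖û(k)‖ ≤ δ_n`,
through a basic neighbourhood of `(û, ‖u‖²)` in the product topology. Packaged as
`stub_augCurrentLevelMargTools`.
-/

noncomputable section

set_option linter.dupNamespace false

open MeasureTheory Set Filter Topology Function Metric UnitAddTorus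
open scoped BigOperators ENNReal InnerProductSpace RealInnerProductSpace

namespace Summit.AnomalousDissipation.AnomalousDissipation.Theorems.EnsembleRealization

open Literature.Analysis.FunctionSpaces Literature.Analysis.FunctionSpaces.Torus
open Literature.Analysis.FluidPDE Literature.Analysis.FluidPDE.Torus

/-- Fourier coefficients of a finite real combination of smooth fields (no prefactor):
`𝓕(Σⱼ wⱼ gⱼ)(k) = Σⱼ wⱼ ĝⱼ(k)`. -/
theorem mFourierCoeff_sum_smul_marg {D : ℕ} {g : Fin D → UnitAddTorus (Fin 3) → EuclideanSpace ℝ (Fin 3)}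
    (hg : ∀ j, IsSmooth (g j)) (w : Fin D → ℝ) (k : Fin 3 → ℤ) :
    mFourierCoeff (EuclideanSpace.complexify ∘ fun x => ∑ j, w j • g j x) k =
      ∑ j, w j • mFourierCoeff (EuclideanSpace.complexify ∘ g j) k := by
  have h := mFourierCoeff_synth_eq_sum hg 1 (WithLp.toLp 2 w) k
  simp only [one_smul, one_mul] at h
  exact h

/-- **Modes of a shifted synthesized field.** For an orthonormal smooth family complete for
`P_N` and `u ∈ H`: `𝓕(θ Σⱼ ((u, gⱼ) + yⱼ) gⱼ)(k) = θ • 𝓕(P_N u)(k) + 𝓕(θ Σⱼ yⱼ gⱼ)(k)` with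
`‖𝓕(θ Σⱼ yⱼ gⱼ)(k)‖ ≤ |θ| ‖y‖`. -/
theorem mFourierCoeff_synth_shift {D : ℕ} {g : Fin D → UnitAddTorus (Fin 3) → EuclideanSpace ℝ (Fin 3)}
    (hg : ∀ j, IsSmooth (g j)) (horth : ∀ i j, ∫ x, ⟪g i x, g j x⟫_ℝ = if i = j then 1 else 0) {N : ℕ}
    (u : Torus.energySpace (Fin 3))
    (hgH : ∀ x, ∑ j, pairing u.1 (g j) • g j x = fourierTruncate N (u.1 : UnitAddTorus (Fin 3) → EuclideanSpace ℝ (Fin 3)) x)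
    (θ : ℝ) (y : EuclideanSpace ℝ (Fin D)) (k : Fin 3 → ℤ) :
    mFourierCoeff (EuclideanSpace.complexify ∘ fun x =>
        θ • ∑ j, ((WithLp.toLp 2 fun j => pairing u.1 (g j)) + y) j • g j x) k =
      θ • (if k ∈ freqBall N then
          mFourierCoeff (EuclideanSpace.complexify ∘ (u.1 : UnitAddTorus (Fin 3) → EuclideanSpace ℝ (Fin 3))) k else 0) +
        mFourierCoeff (EuclideanSpace.complexify ∘ fun x => θ • ∑ j, y j • g j x) k ∧
    ‖mFourierCoeff (EuclideanSpace.complexify ∘ fun x => θ • ∑ j, y j • g j x) k‖ ≤ |θ| * ‖y‖ := by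
  have hu : Integrable (u.1 : UnitAddTorus (Fin 3) → EuclideanSpace ℝ (Fin 3)) volume :=
    (Lp.memLp u.1).integrable one_le_two
  have hP : mFourierCoeff (EuclideanSpace.complexify ∘ fun x => ∑ j, pairing u.1 (g j) • g j x) k =
      if k ∈ freqBall N then
        mFourierCoeff (EuclideanSpace.complexify ∘ (u.1 : UnitAddTorus (Fin 3) → EuclideanSpace ℝ (Fin 3))) k else 0 := by
    rw [show (fun x => ∑ j, pairing u.1 (g j) • g j x) =
      fourierTruncate N (u.1 : UnitAddTorus (Fin 3) → EuclideanSpace ℝ (Fin 3)) from funext hgH]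
    exact mFourierCoeff_fourierTruncate hu N k
  refine ⟨?_, ?_⟩
  · rw [mFourierCoeff_synth_eq_sum hg, mFourierCoeff_synth_eq_sum hg, ← hP, mFourierCoeff_sum_smul_marg hg,
      Finset.smul_sum, ← Finset.sum_add_distrib]
    refine Finset.sum_congr rfl fun j _ => ?_
    rw [PiLp.add_apply, PiLp.toLp_apply, smul_smul, ← add_smul, mul_add]
  · have h := sum_norm_sq_mFourierCoeff_synth_le hg horth θ y {k}
    rw [Finset.sum_singleton, ← mul_pow, ← sq_abs (θ * ‖y‖), abs_mul, abs_norm] at h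
    exact (sq_le_sq₀ (norm_nonneg _) (mul_nonneg (abs_nonneg _) (norm_nonneg _))).1 h

/-- **Pointwise convergence of the level modes, uniformly over the mollification box.** For
`u` in the ball, a continuous test `φ` and `ε' > 0`: eventually in `n`, for every shift `y` with
`‖y.1‖ < δ n`, `|y.2| < δ n`,
`|φ(𝓕(θ_n Σⱼ ((u, gⱼ) + yⱼ) gⱼ), ‖u‖² + y.2) − φ(û, ‖u‖²)| < ε'`. -/
theorem marg_pointwise {R : ℝ} (hR0 : 0 ≤ R)
    (D : ℕ → ℕ) (g : (n : ℕ) → Fin (D n) → UnitAddTorus (Fin 3) → EuclideanSpace ℝ (Fin 3))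
    (N : ℕ → ℕ) (δ θ : ℕ → ℝ)
    (hN : Tendsto N atTop atTop) (hδ : ∀ n, 0 < δ n) (hδ0 : Tendsto δ atTop (𝓝 0))
    (hθ : ∀ n, θ n = R / (R + δ n))
    (hg : ∀ n j, IsSmooth (g n j)) (horth : ∀ n i j, ∫ x, ⟪g n i x, g n j x⟫_ℝ = if i = j then 1 else 0)
    (u : Torus.energySpace (Fin 3)) (hu : ‖u‖ ≤ R)
    (hgH : ∀ n x, ∑ j, pairing u.1 (g n j) • g n j x =
      fourierTruncate (N n) (u.1 : UnitAddTorus (Fin 3) → EuclideanSpace ℝ (Fin 3)) x)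
    {φ : ((Fin 3 → ℤ) → EuclideanSpace ℂ (Fin 3)) × ℝ → ℝ} (hφ : Continuous φ) {ε' : ℝ} (hε' : 0 < ε') :
    ∀ᶠ n in atTop, ∀ y : EuclideanSpace ℝ (Fin (D n)) × ℝ, ‖y.1‖ < δ n → |y.2| < δ n →
      |φ ((fun k : Fin 3 → ℤ => mFourierCoeff (EuclideanSpace.complexify ∘ fun x => θ n • ∑ j,
          ((WithLp.toLp 2 fun j => pairing u.1 (g n j)) + y.1) j • g n j x) k), ‖u‖ ^ 2 + y.2) -
        φ ((fun k : Fin 3 → ℤ => mFourierCoeff (EuclideanSpace.complexify ∘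
          (u.1 : UnitAddTorus (Fin 3) → EuclideanSpace ℝ (Fin 3))) k), ‖u‖ ^ 2)| < ε' := by
  set x₀ : ((Fin 3 → ℤ) → EuclideanSpace ℂ (Fin 3)) × ℝ :=
    ((fun k : Fin 3 → ℤ => mFourierCoeff (EuclideanSpace.complexify ∘
      (u.1 : UnitAddTorus (Fin 3) → EuclideanSpace ℝ (Fin 3))) k), ‖u‖ ^ 2) with hx₀
  have hV : φ ⁻¹' ball (φ x₀) ε' ∈ 𝓝 x₀ := hφ.continuousAt.preimage_mem_nhds (ball_mem_nhds _ hε')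
  rw [hx₀] at hV
  obtain ⟨U, hU, W, hW, hUW⟩ := mem_nhds_prod_iff.1 hV
  rw [nhds_pi] at hU
  obtain ⟨I, hI, t, ht, hIt⟩ := Filter.mem_pi.1 hU
  have hr : ∀ k, ∃ r > 0, ball (x₀.1 k) r ⊆ t k := fun k => Metric.mem_nhds_iff.1 (ht k)
  choose r hr0 hrt using hr
  obtain ⟨r', hr'0, hr'W⟩ := Metric.mem_nhds_iff.1 hW
  -- `θ_n ∈ [0, 1]` and `(1 − θ_n) R ≤ δ_n`
  have hθ01 : ∀ n, 0 ≤ θ n ∧ θ n ≤ 1 ∧ (1 - θ n) * R ≤ δ n := fun n => by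
    have hRδ : 0 < R + δ n := by linarith [hδ n]
    refine ⟨by rw [hθ n]; exact div_nonneg hR0 hRδ.le, by rw [hθ n, div_le_one hRδ]; linarith [hδ n], ?_⟩
    have h1 : (1 - θ n) * R = δ n * (R / (R + δ n)) := by
      rw [hθ n]; field_simp; ring
    rw [h1]
    have h2 : R / (R + δ n) ≤ 1 := by rw [div_le_one hRδ]; linarith [hδ n]
    nlinarith [hδ n, div_nonneg hR0 hRδ.le]
  -- eventually the modes in `I` are resolved, `2 δ_n < r k`, and `δ_n < r'`
  have h1 : ∀ᶠ n in atTop, ∀ k ∈ I, k ∈ freqBall (N n) ∧ 2 * δ n < r k := by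
    refine (eventually_all_finite hI).2 fun k _ => ?_
    have hk : ∀ᶠ n in atTop, k ∈ freqBall (N n) := by
      filter_upwards [hN.eventually (eventually_ge_atTop (⌈freqNormSq k⌉₊ + 1))] with n hn
      rw [mem_freqBall]
      have h1 : (freqNormSq k : ℝ) ≤ ⌈freqNormSq k⌉₊ := Nat.le_ceil _
      have h2 : ((⌈freqNormSq k⌉₊ + 1 : ℕ) : ℝ) ≤ N n := by exact_mod_cast hn
      push_cast at h2
      have h0 : (0 : ℝ) ≤ ⌈freqNormSq k⌉₊ := Nat.cast_nonneg _
      nlinarith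
    have hd : ∀ᶠ n in atTop, 2 * δ n < r k :=
      (hδ0.eventually (gt_mem_nhds (half_pos (hr0 k)))).mono fun n hn => by linarith
    exact hk.and hd
  have h2 : ∀ᶠ n in atTop, δ n < r' := hδ0.eventually (gt_mem_nhds hr'0)
  filter_upwards [h1, h2] with n hn hn' y hy1 hy2
  have hmem : ((fun k : Fin 3 → ℤ => mFourierCoeff (EuclideanSpace.complexify ∘ fun x => θ n • ∑ j,
      ((WithLp.toLp 2 fun j => pairing u.1 (g n j)) + y.1) j • g n j x) k), ‖u‖ ^ 2 + y.2) ∈ U ×ˢ W := by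
    refine Set.mem_prod.2 ⟨hIt (Set.mem_pi.2 fun k hk => hrt k ?_), hr'W ?_⟩
    · -- a resolved mode `k ∈ I`
      obtain ⟨hkN, hkδ⟩ := hn k hk
      obtain ⟨hΨ, hY⟩ := mFourierCoeff_synth_shift (hg n) (horth n) u (hgH n) (θ n) y.1 k
      obtain ⟨hθ0, hθ1, hθR⟩ := hθ01 n
      have hû : ‖mFourierCoeff (EuclideanSpace.complexify ∘
          (u.1 : UnitAddTorus (Fin 3) → EuclideanSpace ℝ (Fin 3))) k‖ ≤ R :=
        (norm_mFourierCoeff_complexify_coe_le u.1 k).trans hu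
      rw [mem_ball, dist_eq_norm]
      dsimp only
      rw [hΨ, if_pos hkN]
      calc ‖θ n • mFourierCoeff (EuclideanSpace.complexify ∘
              (u.1 : UnitAddTorus (Fin 3) → EuclideanSpace ℝ (Fin 3))) k +
            mFourierCoeff (EuclideanSpace.complexify ∘ fun x => θ n • ∑ j, y.1 j • g n j x) k - x₀.1 k‖
          = ‖(θ n - 1) • mFourierCoeff (EuclideanSpace.complexify ∘
              (u.1 : UnitAddTorus (Fin 3) → EuclideanSpace ℝ (Fin 3))) k +
            mFourierCoeff (EuclideanSpace.complexify ∘ fun x => θ n • ∑ j, y.1 j • g n j x) k‖ := by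
            congr 1; rw [sub_smul, one_smul, hx₀]; abel
        _ ≤ ‖(θ n - 1) • mFourierCoeff (EuclideanSpace.complexify ∘
              (u.1 : UnitAddTorus (Fin 3) → EuclideanSpace ℝ (Fin 3))) k‖ +
            ‖mFourierCoeff (EuclideanSpace.complexify ∘ fun x => θ n • ∑ j, y.1 j • g n j x) k‖ := norm_add_le _ _
        _ ≤ (1 - θ n) * R + |θ n| * ‖y.1‖ := by
            refine add_le_add ?_ hY
            rw [norm_smul, Real.norm_eq_abs, abs_sub_comm, abs_of_nonneg (by linarith)]
            exact mul_le_mul_of_nonneg_left hû (by linarith)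
        _ ≤ δ n + δ n := by
            refine add_le_add hθR ?_
            rw [abs_of_nonneg hθ0]
            nlinarith [norm_nonneg y.1]
        _ < r k := by linarith
    · rw [mem_ball, Real.dist_eq]
      dsimp only
      rw [add_sub_cancel_left]
      exact hy2.trans hn'
  have h := hUW hmem
  rwa [Set.mem_preimage, mem_ball, Real.dist_eq] at h

/-- **MARG tools for (M1a), piece (L5).** See the module docstring. -/
theorem stub_augCurrentLevelMargTools {ν : ℝ} {f : UnitAddTorus (Fin 3) → EuclideanSpace ℝ (Fin 3)}
    {μ : Measure (Torus.energySpace (Fin 3))} (hμ : IsStationaryStatisticalSolution ν f μ)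
    {R : ℝ} (hR : ∀ᵐ u ∂μ, ‖u‖ ≤ R) (hR0 : 0 ≤ R)
    (D : ℕ → ℕ) (g : (n : ℕ) → Fin (D n) → UnitAddTorus (Fin 3) → EuclideanSpace ℝ (Fin 3))
    (N : ℕ → ℕ) (δ ε c θ : ℕ → ℝ)
    (ρ₁ : (n : ℕ) → EuclideanSpace ℝ (Fin (D n)) → ℝ) (ρ₂ : ℕ → ℝ → ℝ)
    (p₁ : (n : ℕ) → EuclideanSpace ℝ (Fin (D n)) × ℝ → ℝ)
    (m : (n : ℕ) → Measure (EuclideanSpace ℝ (Fin (D n)) × ℝ))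
    (hN : Tendsto N atTop atTop) (hδ : ∀ n, 0 < δ n) (hδ0 : Tendsto δ atTop (𝓝 0))
    (hε : ∀ n, 0 < ε n ∧ ε n < 1) (hε0 : Tendsto ε atTop (𝓝 0))
    (hθ : ∀ n, θ n = R / (R + δ n))
    (hg : ∀ n j, IsSmooth (g n j))
    (horth : ∀ n i j, ∫ x, ⟪g n i x, g n j x⟫_ℝ = if i = j then 1 else 0)
    (hgH : ∀ n (u : Torus.energySpace (Fin 3)) x, ∑ j, pairing u.1 (g n j) • g n j x =
      fourierTruncate (N n) (u.1 : UnitAddTorus (Fin 3) → EuclideanSpace ℝ (Fin 3)) x)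
    (hρ₁ : ∀ n, Continuous (ρ₁ n) ∧ (∀ y, 0 ≤ ρ₁ n y) ∧ (∀ y, δ n ≤ ‖y‖ → ρ₁ n y = 0) ∧ ∫ y, ρ₁ n y = 1)
    (hρ₂ : ∀ n, Continuous (ρ₂ n) ∧ (∀ s, 0 ≤ ρ₂ n s) ∧ (∀ s, s ∉ Ioo 0 (δ n) → ρ₂ n s = 0) ∧ ∫ s, ρ₂ n s = 1)
    (hp1 : ∀ n, ∫ z, p₁ n z ∂((volume : Measure (EuclideanSpace ℝ (Fin (D n)))).prod (volume : Measure ℝ)) = 1)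
    (hpZ : ∀ n (z : EuclideanSpace ℝ (Fin (D n)) × ℝ),
      p₁ n z = ∫ u, ρ₁ n (z.1 - WithLp.toLp 2 fun j => pairing u.1 (g n j)) * ρ₂ n (z.2 - ‖u‖ ^ 2) ∂μ)
    (hm : ∀ n, IsProbabilityMeasure (m n))
    (htr : ∀ n (G : EuclideanSpace ℝ (Fin (D n)) × ℝ → ℝ), Continuous G →
      ∫ z, G z ∂(m n) = (1 - ε n) * ∫ z, G z * p₁ n z ∂((volume : Measure (EuclideanSpace ℝ (Fin (D n)))).prod (volume : Measure ℝ)) +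
        ε n * c n * ∫ z in closedBall (0 : EuclideanSpace ℝ (Fin (D n))) (R + δ n) ×ˢ Icc 0 (R ^ 2 + δ n), G z
          ∂((volume : Measure (EuclideanSpace ℝ (Fin (D n)))).prod (volume : Measure ℝ))) :
    ∀ φ : ((Fin 3 → ℤ) → EuclideanSpace ℂ (Fin 3)) × ℝ → ℝ, Continuous φ →
        (∃ B : ℝ, ∀ z, |φ z| ≤ B) →
        Tendsto (fun n => ∫ z, φ ((fun k : Fin 3 → ℤ =>
            mFourierCoeff (EuclideanSpace.complexify ∘ fun x => θ n • ∑ j, z.1 j • g n j x) k), z.2) ∂(m n)) atTop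
          (𝓝 (∫ u, φ ((fun k : Fin 3 → ℤ => mFourierCoeff (EuclideanSpace.complexify ∘ (u.1 : UnitAddTorus (Fin 3) → EuclideanSpace ℝ (Fin 3))) k), ‖u‖ ^ 2) ∂μ)) := by
  intro φ hφ hφB
  obtain ⟨B, hB⟩ := hφB
  haveI := hμ.prob
  -- level objects
  let Ψ : (n : ℕ) → EuclideanSpace ℝ (Fin (D n)) × ℝ → ((Fin 3 → ℤ) → EuclideanSpace ℂ (Fin 3)) × ℝ :=
    fun n z => ((fun k : Fin 3 → ℤ => mFourierCoeff (EuclideanSpace.complexify ∘ fun x => θ n • ∑ j, z.1 j • g n j x) k), z.2)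
  let G : (n : ℕ) → EuclideanSpace ℝ (Fin (D n)) × ℝ → ℝ := fun n z => φ (Ψ n z)
  let Z : (n : ℕ) → Torus.energySpace (Fin 3) → EuclideanSpace ℝ (Fin (D n)) × ℝ :=
    fun n u => (WithLp.toLp 2 fun j => pairing u.1 (g n j), ‖u‖ ^ 2)
  let ρ : (n : ℕ) → EuclideanSpace ℝ (Fin (D n)) × ℝ → ℝ := fun n y => ρ₁ n y.1 * ρ₂ n y.2
  let x₀ : Torus.energySpace (Fin 3) → ((Fin 3 → ℤ) → EuclideanSpace ℂ (Fin 3)) × ℝ := fun u =>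
    ((fun k : Fin 3 → ℤ => mFourierCoeff (EuclideanSpace.complexify ∘ (u.1 : UnitAddTorus (Fin 3) → EuclideanSpace ℝ (Fin 3))) k), ‖u‖ ^ 2)
  have hΨc : ∀ n, Continuous (Ψ n) := fun n =>
    (continuous_pi fun k => (continuous_mFourierCoeff_synth (hg n) (θ n) k).comp continuous_fst).prodMk continuous_snd
  have hGc : ∀ n, Continuous (G n) := fun n => hφ.comp (hΨc n)
  have hGB : ∀ n z, |G n z| ≤ B := fun n z => hB _
  have hB0 : 0 ≤ B := (abs_nonneg _).trans (hB (x₀ 0))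
  have hρc : ∀ n, Continuous (ρ n) := fun n =>
    ((hρ₁ n).1.comp continuous_fst).mul ((hρ₂ n).1.comp continuous_snd)
  have hρ0 : ∀ n y, 0 ≤ ρ n y := fun n y => mul_nonneg ((hρ₁ n).2.1 _) ((hρ₂ n).2.1 _)
  have hρcs : ∀ n, HasCompactSupport (ρ n) := fun n => by
    refine HasCompactSupport.intro (K := closedBall (0 : EuclideanSpace ℝ (Fin (D n))) (δ n) ×ˢ Icc 0 (δ n))
      ((isCompact_closedBall _ _).prod isCompact_Icc) fun y hy => ?_
    rcases not_and_or.1 (fun h => hy (Set.mem_prod.2 h)) with h | h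
    · show ρ₁ n y.1 * ρ₂ n y.2 = 0
      rw [(hρ₁ n).2.2.1 _ (not_lt.1 fun h' => h (mem_closedBall_zero_iff.2 h'.le)), zero_mul]
    · show ρ₁ n y.1 * ρ₂ n y.2 = 0
      rw [(hρ₂ n).2.2.1 _ fun h' => h (Ioo_subset_Icc_self h'), mul_zero]
  have hρi : ∀ n, Integrable (ρ n) ((volume : Measure (EuclideanSpace ℝ (Fin (D n)))).prod (volume : Measure ℝ)) :=
    fun n => (hρc n).integrable_of_hasCompactSupport (hρcs n)
  have hρ1 : ∀ n, ∫ y, ρ n y ∂((volume : Measure (EuclideanSpace ℝ (Fin (D n)))).prod (volume : Measure ℝ)) = 1 := fun n => by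
    show ∫ y, ρ₁ n y.1 * ρ₂ n y.2 ∂((volume : Measure (EuclideanSpace ℝ (Fin (D n)))).prod (volume : Measure ℝ)) = 1
    rw [integral_prod_mul, (hρ₁ n).2.2.2, (hρ₂ n).2.2.2, one_mul]
  have hZm : ∀ n, Measurable (Z n) := fun n =>
    (((PiLp.continuous_toLp 2 _).comp (continuous_pi fun j => continuous_pairing_coe ((hg n j).memLp 2))).prodMk
      (continuous_norm.pow 2)).measurable
  have hBxfin : ∀ n, ((volume : Measure (EuclideanSpace ℝ (Fin (D n)))).prod (volume : Measure ℝ))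
      (closedBall (0 : EuclideanSpace ℝ (Fin (D n))) (R + δ n) ×ˢ Icc 0 (R ^ 2 + δ n)) < ∞ := fun n =>
    ((isCompact_closedBall _ _).prod isCompact_Icc).measure_lt_top
  -- transport
  have hT := fun n => stub_augCurrentLevelTransportTools μ
    ((volume : Measure (EuclideanSpace ℝ (Fin (D n)))).prod (volume : Measure ℝ)) (hZm n) (hρc n) (hρ0 n) (hρi n)
    (hGc n) (hGB n)
  have hdec : ∀ n, ∫ z, G n z ∂(m n) = (1 - ε n) * ∫ u, ∫ y, G n (Z n u + y) * ρ n y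
      ∂((volume : Measure (EuclideanSpace ℝ (Fin (D n)))).prod (volume : Measure ℝ)) ∂μ +
      ε n * c n * ∫ z in closedBall (0 : EuclideanSpace ℝ (Fin (D n))) (R + δ n) ×ˢ Icc 0 (R ^ 2 + δ n), G n z
        ∂((volume : Measure (EuclideanSpace ℝ (Fin (D n)))).prod (volume : Measure ℝ)) := fun n => by
    rw [htr n _ (hGc n), ← (hT n).1]
    have hp' : ∀ z, p₁ n z = ∫ u, ρ n (z - Z n u) ∂μ := fun z => hpZ n z
    simp_rw [hp']
  have hunif : ∀ n, |ε n * c n * ∫ z in closedBall (0 : EuclideanSpace ℝ (Fin (D n))) (R + δ n) ×ˢ Icc 0 (R ^ 2 + δ n),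
      G n z ∂((volume : Measure (EuclideanSpace ℝ (Fin (D n)))).prod (volume : Measure ℝ))| ≤ ε n * B := fun n =>
    ((hT n).2.2.2 (m n) (ε n) (c n) (p₁ n) _ (hm n) (hε n).1 (hBxfin n) (hp1 n) (htr n)).2
  -- dominated convergence for the mollified observable
  have hlim : Tendsto (fun n => ∫ u, ∫ y, G n (Z n u + y) * ρ n y
      ∂((volume : Measure (EuclideanSpace ℝ (Fin (D n)))).prod (volume : Measure ℝ)) ∂μ) atTop
      (𝓝 (∫ u, φ (x₀ u) ∂μ)) := by
    refine tendsto_integral_of_dominated_convergence (fun _ => B) (fun n => (hT n).2.1.aestronglyMeasurable)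
      (integrable_const B) (fun n => Eventually.of_forall fun u => ?_) ?_
    · rw [Real.norm_eq_abs]
      have h := (hT n).2.2.1 u
      rwa [hρ1 n, mul_one] at h
    · filter_upwards [hR] with u hu
      rw [Metric.tendsto_nhds]
      intro ε' hε'
      filter_upwards [marg_pointwise hR0 D g N δ θ hN hδ hδ0 hθ hg horth u hu (fun n => hgH n u) hφ (half_pos hε')]
        with n hn
      have hi1 : Integrable (fun y => G n (Z n u + y) * ρ n y)
          ((volume : Measure (EuclideanSpace ℝ (Fin (D n)))).prod (volume : Measure ℝ)) :=
        (hρi n).bdd_mul (((hGc n).comp (continuous_const.add continuous_id)).aestronglyMeasurable)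
          (Eventually.of_forall fun y => by rw [Real.norm_eq_abs]; exact hGB n _)
      have heq : (∫ y, G n (Z n u + y) * ρ n y ∂((volume : Measure (EuclideanSpace ℝ (Fin (D n)))).prod
          (volume : Measure ℝ))) - φ (x₀ u) =
          ∫ y, (G n (Z n u + y) - φ (x₀ u)) * ρ n y ∂((volume : Measure (EuclideanSpace ℝ (Fin (D n)))).prod
            (volume : Measure ℝ)) := by
        simp_rw [sub_mul]
        rw [integral_sub hi1 ((hρi n).const_mul _), integral_const_mul, hρ1 n, mul_one]
      rw [Real.dist_eq, heq]
      have hpt : ∀ y, ‖(G n (Z n u + y) - φ (x₀ u)) * ρ n y‖ ≤ ε' / 2 * ρ n y := fun y => by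
        by_cases hy : ρ n y = 0
        · rw [hy, mul_zero, mul_zero, norm_zero]
        have hy1 : ‖y.1‖ < δ n := not_le.1 fun h' => hy (by
          show ρ₁ n y.1 * ρ₂ n y.2 = 0
          rw [(hρ₁ n).2.2.1 _ h', zero_mul])
        have hy2' : y.2 ∈ Ioo 0 (δ n) := by
          by_contra h'
          exact hy (by
            show ρ₁ n y.1 * ρ₂ n y.2 = 0
            rw [(hρ₂ n).2.2.1 _ h', mul_zero])
        have hy2 : |y.2| < δ n := by rw [abs_of_pos hy2'.1]; exact hy2'.2
        rw [Real.norm_eq_abs, abs_mul, abs_of_nonneg (hρ0 n y)]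
        exact mul_le_mul_of_nonneg_right (hn y hy1 hy2).le (hρ0 n y)
      calc |∫ y, (G n (Z n u + y) - φ (x₀ u)) * ρ n y ∂((volume : Measure (EuclideanSpace ℝ (Fin (D n)))).prod
              (volume : Measure ℝ))|
          ≤ ∫ y, ε' / 2 * ρ n y ∂((volume : Measure (EuclideanSpace ℝ (Fin (D n)))).prod (volume : Measure ℝ)) := by
            rw [← Real.norm_eq_abs]
            exact norm_integral_le_of_norm_le ((hρi n).const_mul _) (Eventually.of_forall hpt)
        _ = ε' / 2 := by rw [integral_const_mul, hρ1 n, mul_one]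
        _ < ε' := half_lt_self hε'
  -- assembling
  have hfin : Tendsto (fun n => (1 - ε n) * ∫ u, ∫ y, G n (Z n u + y) * ρ n y
      ∂((volume : Measure (EuclideanSpace ℝ (Fin (D n)))).prod (volume : Measure ℝ)) ∂μ +
      ε n * c n * ∫ z in closedBall (0 : EuclideanSpace ℝ (Fin (D n))) (R + δ n) ×ˢ Icc 0 (R ^ 2 + δ n), G n z
        ∂((volume : Measure (EuclideanSpace ℝ (Fin (D n)))).prod (volume : Measure ℝ))) atTop
      (𝓝 ((1 - 0) * (∫ u, φ (x₀ u) ∂μ) + 0)) := by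
    refine ((tendsto_const_nhds.sub hε0).mul hlim).add ?_
    refine squeeze_zero_norm (fun n => ?_) (by simpa using hε0.mul_const B)
    rw [Real.norm_eq_abs]
    exact hunif n
  rw [sub_zero, one_mul, add_zero] at hfin
  exact hfin.congr' (Eventually.of_forall fun n => (hdec n).symm)

end Summit.AnomalousDissipation.AnomalousDissipation.Theorems.EnsembleRealization
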